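import Literature.RingTheory.HilbertSamuel.GenericNormalFlatness
import Literature.RingTheory.HilbertSamuel.GradedPieceLocalization
import Literature.RingTheory.HilbertSamuel.NormalFlatness
import Literature.RingTheory.HilbertSamuel.PsiSemicontinuity
import Mathlib.RingTheory.Localization.BaseChange
import Mathlib.RingTheory.Localization.Away.Basic
import Mathlib.RingTheory.Flat.Stability
import Mathlib.LinearAlgebra.TensorProduct.Tower
import HarnessLib

/-!
# Generic normal flatness at the local rings: `A_𝔮` is normally flat along `𝔭A_𝔮` for all
# `𝔮 ∈ V(𝔭) ∩ D(s)` (CJS 2020, Thm. 3.2 (1), ring form)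

Topic: `Literature/RingTheory/HilbertSamuel`. Cossart–Jannsen–Saito, LNM 2270, Thm. 3.2 (1): "There
is a dense open subset `U ⊂ D` such that `X` is normally flat along `D` at all `x ∈ U`", normal
flatness at `x` being flatness of `gr_{I_D}(𝒪_X)_x` over `𝒪_{D,x}` (Def. 3.1; in the local ring:
`Ideal.IsNormallyFlat`, `NormalFlatness.lean`). This file PROVES the ring-theoretic form for an
affine piece `X = Spec A`, `D = V(𝔭)` (`A` Noetherian, `𝔭` prime):

* `isNormallyFlat_map_of_projective_localizedModule` — if `s ∈ A ∖ 𝔮` and all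
  `(𝔭ⁿ/𝔭ⁿ⁺¹)[1/s̄]` are projective over `(A/𝔭)[1/s̄]`, then for every prime `𝔮 ⊇ 𝔭` with `s ∉ 𝔮`
  and every localization `A_𝔮` of `A` at `𝔮`, the ideal `𝔭A_𝔮` is normally flat: its graded
  pieces `(𝔭A_𝔮)ⁿ/(𝔭A_𝔮)ⁿ⁺¹ = (𝔭ⁿ/𝔭ⁿ⁺¹) ⊗_{A/𝔭} (A_𝔮/𝔭A_𝔮)` (`GradedPieceLocalization.lean`) are
  base changes of the flat modules `(𝔭ⁿ/𝔭ⁿ⁺¹)[1/s̄]` along `(A/𝔭)[1/s̄] → A_𝔮/𝔭A_𝔮`;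
* `exists_forall_isNormallyFlat_map` — **generic normal flatness**: there is `s ∉ 𝔭` such that
  `𝔭A_𝔮` is normally flat in `A_𝔮` for all primes `𝔮 ⊇ 𝔭` not containing `s`, i.e. `Spec A` is
  normally flat along `V(𝔭)` on the dense open `V(𝔭) ∩ D(s)` of `V(𝔭)`
  (`exists_projective_localizedModule_gradedPiece`, `GenericNormalFlatness.lean`).

The scheme-level statement (stalks of a locally noetherian scheme along an integral closed
subscheme) is NOT formulated here. No definitions and no named facts are introduced.

## Sources

* V. Cossart, U. Jannsen, S. Saito, *Desingularization: Invariants and Strategy*, LNM 2270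
  (2020), Def. 3.1, Thm. 3.2 (1) (p. 37–38). [CossartJannsenSaito2020]
* H. Hironaka, Ann. of Math. 79 (1964), Ch. I, Thm. 1 (as cited by CJS; not consulted).
  [Hironaka1964]
-/

noncomputable section

open TensorProduct

namespace Literature.RingTheory.HilbertSamuel

universe u v

variable {A : Type u} [CommRing A] (p q : Ideal A) [q.IsPrime]
variable (A' : Type v) [CommRing A'] [Algebra A A'] [IsLocalization.AtPrime A' q]

/-- **Normal flatness of `A_𝔮` along `𝔭A_𝔮` from generic projectivity.** Let `𝔭 ⊆ 𝔮` be primes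
of a Noetherian ring `A`, `s ∉ 𝔮`, and suppose every `(𝔭ⁿ/𝔭ⁿ⁺¹)[1/s̄]` is a projective
`(A/𝔭)[1/s̄]`-module (`s̄` the class of `s`). Then for any localization `A_𝔮` of `A` at `𝔮` the
ideal `𝔭A_𝔮` is normally flat (CJS Def. 3.1): `(𝔭A_𝔮)ⁿ/(𝔭A_𝔮)ⁿ⁺¹ ≅ (A_𝔮/𝔭A_𝔮) ⊗_{A/𝔭} 𝔭ⁿ/𝔭ⁿ⁺¹
≅ (A_𝔮/𝔭A_𝔮) ⊗_{(A/𝔭)[1/s̄]} (𝔭ⁿ/𝔭ⁿ⁺¹)[1/s̄]` is flat over `A_𝔮/𝔭A_𝔮`.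
[cite: CossartJannsenSaito2020, Thm. 3.2 (1)] -/
theorem isNormallyFlat_map_of_projective_localizedModule (hpq : p ≤ q) {s : A} (hs : s ∉ q)
    (hproj : ∀ n, Module.Projective (Localization.Away (Ideal.Quotient.mk p s))
      (LocalizedModule (Submonoid.powers (Ideal.Quotient.mk p s)) (gradedPiece p n))) :
    (p.map (algebraMap A A')).IsNormallyFlat := by
  intro n
  haveI : IsLocalRing A' := IsLocalization.AtPrime.isLocalRing A' q
  set P : Ideal A' := p.map (algebraMap A A') with hP
  -- the prime `𝔮̄ = 𝔮/𝔭` of `Ā = A/𝔭`; `L = A_𝔮/𝔭A_𝔮` is the localization of `Ā` at `𝔮̄`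
  set qb : Ideal (A ⧸ p) := q.map (Ideal.Quotient.mk p) with hqb
  haveI hqbprime : qb.IsPrime := Ideal.isPrime_map_quotientMk_of_isPrime hpq
  have hqbcomap : qb.comap (Ideal.Quotient.mk p) = q := by
    rw [hqb, Ideal.comap_map_of_surjective _ Ideal.Quotient.mk_surjective,
      ← RingHom.ker_eq_comap_bot, Ideal.mk_ker, sup_eq_left.mpr hpq]
  have hmem : ∀ {t : A}, t ∉ q → Ideal.Quotient.mk p t ∈ qb.primeCompl := by
    intro t ht htq
    apply ht
    rw [← hqbcomap]
    exact htq
  haveI hL : IsLocalization qb.primeCompl (A' ⧸ P) := by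
    have hinst : IsLocalization (Algebra.algebraMapSubmonoid (A ⧸ p) q.primeCompl) (A' ⧸ P) :=
      inferInstance
    rwa [algebraMapSubmonoid_quotient_primeCompl A q hpq] at hinst
  -- the modules `M = 𝔭ⁿ/𝔭ⁿ⁺¹` (over `Ā`) and `N = (𝔭A_𝔮)ⁿ/(𝔭A_𝔮)ⁿ⁺¹` (over `L`, hence over `Ā`)
  letI instMod : Module (A ⧸ p) (gradedPiece P n) :=
    Module.compHom (gradedPiece P n) (algebraMap (A ⧸ p) (A' ⧸ P))
  haveI : IsScalarTower (A ⧸ p) (A' ⧸ P) (gradedPiece P n) :=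
    IsScalarTower.of_algebraMap_smul fun _ _ => rfl
  haveI hAAb : IsScalarTower A (A ⧸ p) (gradedPiece P n) := by
    refine IsScalarTower.of_algebraMap_smul fun a y => ?_
    change (Ideal.Quotient.mk P (algebraMap A A' a)) • y = a • y
    rw [show (Ideal.Quotient.mk P (algebraMap A A' a)) • y = (algebraMap A A' a) • y from rfl,
      algebraMap_smul]
  -- `θ : M → N` is a localization at `𝔮 ∖ A`, hence `θ̄` one at `𝔮̄ᶜ ⊆ Ā`
  obtain ⟨θ, hθloc, hθ⟩ := exists_isLocalizedModule_gradedPiece q.primeCompl A' p n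
  let θ' : gradedPiece p n →ₗ[A ⧸ p] gradedPiece P n :=
    θ.extendScalarsOfSurjective Ideal.Quotient.mk_surjective
  have hθ' : ∀ x, θ' x = θ x := fun x => rfl
  haveI hθ'loc : IsLocalizedModule qb.primeCompl θ' := by
    refine ⟨?_, ?_, ?_⟩
    · rintro ⟨sb, hsb⟩
      obtain ⟨t, rfl⟩ := Ideal.Quotient.mk_surjective sb
      have ht : t ∈ q.primeCompl := fun htq => hsb (Ideal.mem_map_of_mem _ htq)
      have hu := hθloc.map_units ⟨t, ht⟩
      rw [Module.End.isUnit_iff] at hu ⊢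
      have heq : ∀ y : gradedPiece P n,
          (algebraMap (A ⧸ p) (Module.End (A ⧸ p) (gradedPiece P n)) (Ideal.Quotient.mk p t)) y =
            (algebraMap A (Module.End A (gradedPiece P n)) t) y := by
        intro y
        simp only [Module.algebraMap_end_apply]
        rw [← Ideal.Quotient.algebraMap_eq, algebraMap_smul]
      constructor
      · intro y y' h
        rw [heq, heq] at h
        exact hu.1 h
      · intro y
        obtain ⟨y', hy'⟩ := hu.2 y
        exact ⟨y', by rw [heq, hy']⟩
    · intro y
      obtain ⟨⟨m, t⟩, h⟩ := hθloc.surj y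
      refine ⟨(m, ⟨Ideal.Quotient.mk p t, hmem t.2⟩), ?_⟩
      change (Ideal.Quotient.mk p (t : A)) • y = θ' m
      rw [hθ', ← h, ← Ideal.Quotient.algebraMap_eq, algebraMap_smul]
      rfl
    · intro x₁ x₂ h
      rw [hθ', hθ'] at h
      obtain ⟨c, hc⟩ := hθloc.exists_of_eq h
      refine ⟨⟨Ideal.Quotient.mk p c, hmem c.2⟩, ?_⟩
      change (Ideal.Quotient.mk p (c : A)) • x₁ = (Ideal.Quotient.mk p (c : A)) • x₂
      rw [← Ideal.Quotient.algebraMap_eq, algebraMap_smul, algebraMap_smul]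
      exact hc
  -- `N = L ⊗_Ā M`
  have hB : IsBaseChange (A' ⧸ P) θ' := IsLocalizedModule.isBaseChange qb.primeCompl (A' ⧸ P) θ'
  -- `L` is an algebra over `Ā[1/s̄]`
  set sb := Ideal.Quotient.mk p s with hsb
  have hunit : IsUnit (algebraMap (A ⧸ p) (A' ⧸ P) sb) :=
    IsLocalization.map_units (A' ⧸ P) (⟨sb, hmem hs⟩ : qb.primeCompl)
  letI instAlg : Algebra (Localization.Away sb) (A' ⧸ P) :=
    (IsLocalization.Away.lift sb (g := algebraMap (A ⧸ p) (A' ⧸ P)) hunit).toAlgebra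
  haveI : IsScalarTower (A ⧸ p) (Localization.Away sb) (A' ⧸ P) :=
    IsScalarTower.of_algebraMap_eq fun a =>
      (IsLocalization.Away.lift_eq sb (g := algebraMap (A ⧸ p) (A' ⧸ P)) hunit a).symm
  -- flatness by base change from the projective `M[1/s̄]`
  haveI := hproj n
  have e₃ : Localization.Away sb ⊗[A ⧸ p] gradedPiece p n ≃ₗ[Localization.Away sb]
      LocalizedModule (Submonoid.powers sb) (gradedPiece p n) :=
    (IsLocalizedModule.isBaseChange (Submonoid.powers sb) (Localization.Away sb)
      (LocalizedModule.mkLinearMap (Submonoid.powers sb) (gradedPiece p n))).equiv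
  haveI : Module.Flat (Localization.Away sb) (Localization.Away sb ⊗[A ⧸ p] gradedPiece p n) :=
    Module.Flat.of_linearEquiv e₃
  have e₂ : (A' ⧸ P) ⊗[Localization.Away sb] (Localization.Away sb ⊗[A ⧸ p] gradedPiece p n)
      ≃ₗ[A' ⧸ P] (A' ⧸ P) ⊗[A ⧸ p] gradedPiece p n :=
    TensorProduct.AlgebraTensorModule.cancelBaseChange (A ⧸ p) (Localization.Away sb)
      (A' ⧸ P) (A' ⧸ P) (gradedPiece p n)
  haveI : Module.Flat (A' ⧸ P) ((A' ⧸ P) ⊗[A ⧸ p] gradedPiece p n) :=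
    Module.Flat.of_linearEquiv e₂.symm
  exact Module.Flat.of_linearEquiv hB.equiv.symm

/-- **Generic normal flatness along `V(𝔭)`** (CJS Thm. 3.2 (1) / Hironaka, for the affine scheme
`Spec A` and its integral closed subscheme `V(𝔭)`): for a Noetherian ring `A` and a prime `𝔭`
there is `s ∉ 𝔭` such that for every prime `𝔮 ⊇ 𝔭` with `s ∉ 𝔮` and every localization `A_𝔮`,
the ideal `𝔭A_𝔮` is normally flat in `A_𝔮` — `Spec A` is normally flat along `V(𝔭)` at all points
of the dense open `V(𝔭) ∩ D(s)`. [cite: CossartJannsenSaito2020, Thm. 3.2 (1)] -/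
theorem exists_forall_isNormallyFlat_map [IsNoetherianRing A] [p.IsPrime] :
    ∃ s : A, s ∉ p ∧ ∀ (q : Ideal A) [q.IsPrime], p ≤ q → s ∉ q →
      ∀ (A' : Type v) [CommRing A'] [Algebra A A'] [IsLocalization.AtPrime A' q],
        (p.map (algebraMap A A')).IsNormallyFlat := by
  obtain ⟨sb, hsb, hproj⟩ := exists_projective_localizedModule_gradedPiece p
  obtain ⟨s, rfl⟩ := Ideal.Quotient.mk_surjective sb
  refine ⟨s, fun hs => hsb (Ideal.Quotient.eq_zero_iff_mem.mpr hs), ?_⟩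
  intro q _ hpq hsq A' _ _ _
  exact isNormallyFlat_map_of_projective_localizedModule p q A' hpq hsq hproj

end Literature.RingTheory.HilbertSamuel
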